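import Summits.HodgeConjecture.HodgeConjecture.Theorems.HodgeLocusCensusUnitRigidityTwo

/-!
# Hodge-locus census, V3-XT N = 1 — THE EXPLICIT UNIT LAW (U2⁺) of DI-gen(2): `|U_{a,m}| = 6 ⟺ x₁² ≡ x₂² ≡ x₃² (mod 2^(m+2))`, coordinate form as THEOREMS

certified instances and evidence bearing on the general Hodge conjecture; no claim.

Setting: `HodgeLocusCensusUnitRigidityTwo` ((U2): for a tower `a` of DI-gen(2) with root `s_a = x₁ i + x₂ j + x₃ k`, all `x_t` odd,
`x₁² + x₂² + x₃² = |D'|`, and `m ≥ 1`, the unit group `U_{a,m}` of `T_{a,m} = ℤ + ℤω_a + 2^m O` (`O` the Hurwitz order, `ω_a = (1 + s_a)/2`)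
has order `2` or `6`, and `6` iff `T_{a,m}` contains one of the sixteen order-3/6 units `±u_ε`, `u_ε = (1 + ε₁ i + ε₂ j + ε₃ k)/2`).
Records: `DERIVATION-DI2-B.md` §2.1 (pub-hlocus cell, seat abs-2 gen 39, engine B).  This file proves the COORDINATE FORM of the criterion:
* `orderSix_unit_mem_tower_of_congr` (⇐, `β` integral): `q x_t = ε_t + 2^(m+1) g_t` (`t = 1,2,3`, `q = 2k+1`) ⇒ `u_ε ∈ T_{a,m}`;
* `orderSix_unit_mem_tower_of_congr_shift` (⇐, `β` half-integral): `q x_t = ε_t + 2^(m+1) + 2^(m+2) g_t` ⇒ `u_ε ∈ T_{a,m+1}`;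
* `congr_of_orderSix_unit_mem_tower` (⇒): `u_ε ∈ T_{a,m}` ⇒ `∃ q, δ ∈ {0, 2^m}, g_t` with `q x_t = ε_t + δ + 2^(m+1) g_t` for all three `t`;
* `sq_congr_of_congr_pm`: for odd `x, y`, `x ≡ ±y (mod 2^(m+1)) ⇒ x² ≡ y² (mod 2^(m+2))`;
* the census instances `example_43_level2` (`43 = 5²+3²+3²`, `|U_{a,2}| = 6`) and `example_163_level2` (`163 = 9²+9²+1²`), behind
  `v₂(j₋₄₃ - j₋₁₆₃) = 12 + 3 + 3 + 1 = 19` (`HodgeLocusCensusInert2Anchors.valuations`).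
Reading (DERIVATION-DI2-B.md §2.1): since `ε(1 + 2^m) ≡ ε + 2^m (mod 2^(m+1))`, both cases of (⇒) say `x_t ≡ ±c (mod 2^(m+1))` for one odd `c`
(`c = q⁻¹`), and (⇐) is the converse; so for every tower and every `m ≥ 1`:
`|U_{a,m}| = 6 ⟺ x₁ ≡ ±x₂ ≡ ±x₃ (mod 2^(m+1)) ⟺ x₁² ≡ x₂² ≡ x₃² (mod 2^(m+2))` — the 2-adic valuations `v₂(j(E_a) - j(E_b)) =
12 + Σ_{1 ≤ n < depth} |U_{a,n}|/2` of DI-gen(2) are explicit in the three-square representations of `|D'|` (Gauss: `r₃(|D'|) = 24 h(D')`,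
the towers are the `A₄ = O^×/±1`-orbits of representations).  Machine-confirmed on every tower of the gen-39 census (`unitlaw_check.py`,
0 mismatches).  The modular inversion `q ↦ c` and the converse of `sq_congr_of_congr_pm` are left as prose.  Nothing here is a statement
about algebraic cycles.
-/

set_option linter.dupNamespace false

namespace Summit.HodgeConjecture.HodgeConjecture.HodgeLocus.Census.UnitLawTwoExplicit

open Summit.HodgeConjecture.HodgeConjecture.HodgeLocus.Census.UnitRigidity
open Summit.HodgeConjecture.HodgeConjecture.HodgeLocus.Census.UnitRigidityTwo

/-- **(U2⁺) COORDINATE FORM, direction ⇐.**  Let `s_a = x₁ i + x₂ j + x₃ k` with `x_t = 2n_t + 1` and `m ≥ 0`.  If an odd `q = 2k + 1` and signs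
`ε_t` satisfy `q·x_t = ε_t + 2^(m+1)·g_t` (`t = 1,2,3`), then the order-6 unit `u_ε = (1 + ε₁ i + ε₂ j + ε₃ k)/2` lies in `T_{a,m} = ℤ + ℤω_a + 2^m O`
(witness `u_ε = -k·1 + q·ω_a + 2^m·(0, -g₁, -g₂, -g₃)`).  With `c = q⁻¹ (mod 2^(m+1))` the hypothesis says `x_t ≡ ε_t c`, i.e. `x₁ ≡ ±x₂ ≡ ±x₃ (mod 2^(m+1))`. -/
theorem orderSix_unit_mem_tower_of_congr (m : ℕ) (n₁ n₂ n₃ ε₁ ε₂ ε₃ k g₁ g₂ g₃ : ℤ)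
    (h₁ : (2 * k + 1) * (2 * n₁ + 1) = ε₁ + 2 ^ (m + 1) * g₁) (h₂ : (2 * k + 1) * (2 * n₂ + 1) = ε₂ + 2 ^ (m + 1) * g₂)
    (h₃ : (2 * k + 1) * (2 * n₃ + 1) = ε₃ + 2 ^ (m + 1) * g₃) :
    half ε₁ ε₂ ε₃ ∈ tower hurwitz (half (2 * n₁ + 1) (2 * n₂ + 1) (2 * n₃ + 1)) ((2 : ℤ) ^ m) := by
  have e₁ : (ε₁ : ℚ) = (2 * k + 1) * (2 * n₁ + 1) - 2 ^ (m + 1) * g₁ := by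
    have := congrArg (Int.cast : ℤ → ℚ) h₁; push_cast at this; linarith
  have e₂ : (ε₂ : ℚ) = (2 * k + 1) * (2 * n₂ + 1) - 2 ^ (m + 1) * g₂ := by
    have := congrArg (Int.cast : ℤ → ℚ) h₂; push_cast at this; linarith
  have e₃ : (ε₃ : ℚ) = (2 * k + 1) * (2 * n₃ + 1) - 2 ^ (m + 1) * g₃ := by
    have := congrArg (Int.cast : ℤ → ℚ) h₃; push_cast at this; linarith
  refine ⟨-k, 2 * k + 1, ![0, -(g₁ : ℚ), -(g₂ : ℚ), -(g₃ : ℚ)], ⟨![0, -g₁, -g₂, -g₃], Or.inl ?_⟩, ?_⟩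
  · funext t; fin_cases t <;> simp
  · ext t; fin_cases t <;> simp [e₁, e₂, e₃] <;> ring

/-- **(U2⁺) COORDINATE FORM, the shifted case ⇐** (`β` half-integral): if `q·x_t = ε_t + 2^(m+1) + 2^(m+2)·g_t` for `t = 1,2,3` (`q = 2k+1`), then
`u_ε ∈ T_{a,m+1}` as well (witness with `β ∈ O` half-integral).  Since `ε + 2^(m+1) ≡ ε·(1 + 2^(m+1)) (mod 2^(m+2))`, this is again `x₁ ≡ ±x₂ ≡ ±x₃ (mod 2^(m+2))`. -/
theorem orderSix_unit_mem_tower_of_congr_shift (m : ℕ) (n₁ n₂ n₃ ε₁ ε₂ ε₃ k g₁ g₂ g₃ : ℤ)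
    (h₁ : (2 * k + 1) * (2 * n₁ + 1) = ε₁ + 2 ^ (m + 1) + 2 ^ (m + 2) * g₁)
    (h₂ : (2 * k + 1) * (2 * n₂ + 1) = ε₂ + 2 ^ (m + 1) + 2 ^ (m + 2) * g₂)
    (h₃ : (2 * k + 1) * (2 * n₃ + 1) = ε₃ + 2 ^ (m + 1) + 2 ^ (m + 2) * g₃) :
    half ε₁ ε₂ ε₃ ∈ tower hurwitz (half (2 * n₁ + 1) (2 * n₂ + 1) (2 * n₃ + 1)) ((2 : ℤ) ^ (m + 1)) := by
  have e₁ : (ε₁ : ℚ) = (2 * k + 1) * (2 * n₁ + 1) - 2 ^ (m + 1) - 2 ^ (m + 2) * g₁ := by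
    have := congrArg (Int.cast : ℤ → ℚ) h₁; push_cast at this; linarith
  have e₂ : (ε₂ : ℚ) = (2 * k + 1) * (2 * n₂ + 1) - 2 ^ (m + 1) - 2 ^ (m + 2) * g₂ := by
    have := congrArg (Int.cast : ℤ → ℚ) h₂; push_cast at this; linarith
  have e₃ : (ε₃ : ℚ) = (2 * k + 1) * (2 * n₃ + 1) - 2 ^ (m + 1) - 2 ^ (m + 2) * g₃ := by
    have := congrArg (Int.cast : ℤ → ℚ) h₃; push_cast at this; linarith
  refine ⟨-k - 2 ^ m, 2 * k + 1, ![1 / 2, -(g₁ : ℚ) - 1 / 2, -(g₂ : ℚ) - 1 / 2, -(g₃ : ℚ) - 1 / 2],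
    ⟨![0, -g₁ - 1, -g₂ - 1, -g₃ - 1], Or.inr ?_⟩, ?_⟩
  · funext t; fin_cases t <;> simp <;> ring
  · ext t; fin_cases t <;> simp [e₁, e₂, e₃] <;> ring

/-- **(U2⁺) COORDINATE FORM, direction ⇒.**  If `u_ε = (1 + ε₁ i + ε₂ j + ε₃ k)/2 ∈ T_{a,m} = ℤ + ℤω_a + 2^m O` (any `m`), then there are `q ∈ ℤ` and a
common shift `δ ∈ {0, 2^m}` with `q·x_t ≡ ε_t + δ (mod 2^(m+1))` for `t = 1, 2, 3` — the two cases being `β ∈ O` integral / half-integral.  (So `q` is odd and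
`x₁ ≡ ±x₂ ≡ ±x₃ (mod 2^(m+1))`; together with the two lemmas above and (U2): `|U_{a,m}| = 6 ⟺ x₁ ≡ ±x₂ ≡ ±x₃ (mod 2^(m+1)) ⟺ x₁² ≡ x₂² ≡ x₃² (mod 2^(m+2))`,
DERIVATION-DI2-B.md §2.1.) -/
theorem congr_of_orderSix_unit_mem_tower (m : ℕ) (x₁ x₂ x₃ ε₁ ε₂ ε₃ : ℚ) {xi₁ xi₂ xi₃ ei₁ ei₂ ei₃ : ℤ}
    (hx₁ : x₁ = xi₁) (hx₂ : x₂ = xi₂) (hx₃ : x₃ = xi₃) (he₁ : ε₁ = ei₁) (he₂ : ε₂ = ei₂) (he₃ : ε₃ = ei₃)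
    (h : half ε₁ ε₂ ε₃ ∈ tower hurwitz (half x₁ x₂ x₃) ((2 : ℤ) ^ m)) :
    ∃ q δ g₁ g₂ g₃ : ℤ, (δ = 0 ∨ δ = 2 ^ m) ∧
      q * xi₁ = ei₁ + δ + 2 ^ (m + 1) * g₁ ∧ q * xi₂ = ei₂ + δ + 2 ^ (m + 1) * g₂ ∧ q * xi₃ = ei₃ + δ + 2 ^ (m + 1) * g₃ := by
  obtain ⟨p, q, β, ⟨n, hn | hn⟩, hv⟩ := h <;> subst hn
  · have c1 := congrFun hv 1; have c2 := congrFun hv 2; have c3 := congrFun hv 3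
    simp at c1 c2 c3
    refine ⟨q, 0, -n 1, -n 2, -n 3, Or.inl rfl, ?_, ?_, ?_⟩
    · have : (q : ℚ) * xi₁ = ei₁ + 0 + 2 ^ (m + 1) * (-(n 1 : ℚ)) := by rw [← hx₁, ← he₁]; linear_combination 2 * c1.symm
      exact_mod_cast this
    · have : (q : ℚ) * xi₂ = ei₂ + 0 + 2 ^ (m + 1) * (-(n 2 : ℚ)) := by rw [← hx₂, ← he₂]; linear_combination 2 * c2.symm
      exact_mod_cast this
    · have : (q : ℚ) * xi₃ = ei₃ + 0 + 2 ^ (m + 1) * (-(n 3 : ℚ)) := by rw [← hx₃, ← he₃]; linear_combination 2 * c3.symm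
      exact_mod_cast this
  · have c1 := congrFun hv 1; have c2 := congrFun hv 2; have c3 := congrFun hv 3
    simp at c1 c2 c3
    refine ⟨q, 2 ^ m, -n 1 - 1, -n 2 - 1, -n 3 - 1, Or.inr rfl, ?_, ?_, ?_⟩
    · have : (q : ℚ) * xi₁ = ei₁ + 2 ^ m + 2 ^ (m + 1) * (-(n 1 : ℚ) - 1) := by rw [← hx₁, ← he₁]; linear_combination 2 * c1.symm
      exact_mod_cast this
    · have : (q : ℚ) * xi₂ = ei₂ + 2 ^ m + 2 ^ (m + 1) * (-(n 2 : ℚ) - 1) := by rw [← hx₂, ← he₂]; linear_combination 2 * c2.symm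
      exact_mod_cast this
    · have : (q : ℚ) * xi₃ = ei₃ + 2 ^ m + 2 ^ (m + 1) * (-(n 3 : ℚ) - 1) := by rw [← hx₃, ← he₃]; linear_combination 2 * c3.symm
      exact_mod_cast this

/-- **(U2⁺) squares form of the congruence**: for odd `x, y`, `x ≡ ±y (mod 2^(m+1))` implies `x² ≡ y² (mod 2^(m+2))` (`x ∓ y` even, `x ± y ≡ 0`). The converse
(exactly one of `x - y`, `x + y` is `≡ 2 (mod 4)`) is recorded in DERIVATION-DI2-B.md §2.1. -/
theorem sq_congr_of_congr_pm (m : ℕ) (a b d : ℤ) (h : (2 * a + 1) - (2 * b + 1) = 2 ^ (m + 1) * d ∨ (2 * a + 1) + (2 * b + 1) = 2 ^ (m + 1) * d) :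
    ∃ e : ℤ, (2 * a + 1) ^ 2 - (2 * b + 1) ^ 2 = 2 ^ (m + 2) * e := by
  rcases h with h | h
  · exact ⟨d * (a + b + 1), by
      have : (2 * a + 1) ^ 2 - (2 * b + 1) ^ 2 = ((2 * a + 1) - (2 * b + 1)) * (2 * (a + b + 1)) := by ring
      rw [this, h]; ring⟩
  · exact ⟨d * (a - b), by
      have : (2 * a + 1) ^ 2 - (2 * b + 1) ^ 2 = ((2 * a + 1) + (2 * b + 1)) * (2 * (a - b)) := by ring
      rw [this, h]; ring⟩

/-- (U2⁺) EXAMPLE `D' = -43 = -(5² + 3² + 3²)`, level `m = 2`: `q = 5`, `5·5 = 25 = 1 + 8·3`, `5·3 = 15 = -1 + 8·2` — so the order-6 unit `(1 + i - j - k)/2` lies in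
`ℤ + ℤω_a + 4O` and `|U_{a,2}| = 6` (census: `v₂(j₋₄₃ - j₋₁₆₃) = 12 + 3 + 3 + 1 = 19`). -/
theorem example_43_level2 : half 1 (-1) (-1) ∈ tower hurwitz (half 5 3 3) ((2 : ℤ) ^ 2) := by
  have := orderSix_unit_mem_tower_of_congr 2 2 1 1 1 (-1) (-1) 2 3 2 2 (by norm_num) (by norm_num) (by norm_num)
  norm_num at this
  exact this

/-- (U2⁺) EXAMPLE `D' = -163 = -(9² + 9² + 1²)`, level `m = 2`: `q = 1`: `9 = 1 + 8`, `1 = 1 + 0` ⇒ `(1 + i + j + k)/2 ∈ ℤ + ℤω_a + 4O`, `|U_{a,2}| = 6`. -/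
theorem example_163_level2 : half 1 1 1 ∈ tower hurwitz (half 9 9 1) ((2 : ℤ) ^ 2) := by
  have := orderSix_unit_mem_tower_of_congr 2 4 4 0 1 1 1 0 1 1 0 (by norm_num) (by norm_num) (by norm_num)
  norm_num at this
  exact this

end Summit.HodgeConjecture.HodgeConjecture.HodgeLocus.Census.UnitLawTwoExplicit
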